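import Summits.QuantumFields.BalabanUV.Beta.GAN24.ContactTentCauchy
import Summits.QuantumFields.BalabanUV.Beta.GAN24.ContactPartnerLetters
import Summits.QuantumFields.BalabanUV.Beta.GAN24.RespStepCauchy

/-!
# `BalabanUV.Beta.GAN24.ContactRefinePTent` — binder row G-an2-4 / (CONV-C), the row owner's CONTACT-TERM ROUTE, CT-4c SHAPE P (road-P2 chair): THE THIRD
# BRACKET's KERNEL — the DIFFERENCE of the two towers' tent kernels at the currency the CT-4b package fixes (`c_ψ = c_χ = (Lc^{d+1})⁻¹`, table currency
# `c₀ = (Lc^{12})⁻¹`) IS `(Lc^4·(Lc^(k+2))^8)⁻¹ ×` CT-4d's unit-tent Cauchy difference, hence `θ_K^k`-small: the `hφt ∕ htt` slots of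
# `ContactRefineP.abs_pairing_refine_le` for the actual kernels `φ′ κ y = wΦ_{Lc^(k+2)} κ μ (y − z)`, `φ κ y = wΦ_{Lc^(k+1)} κ μ (y − z)` (`d = 3`, every `Lc ≥ 2`).

NOT IN PRINT; OUR BOOKKEEPING (road-P2 chair `b2b-balaban-gan24-p2`, gen 34; «MINE (CT-4c-P)»).  [folklore] packaging: CT-4d `ContactTentCauchy.exists_unitTent_letters_three`
(the K-slot's all-scales letter `hKall` on the mm-block, `KSlotAssembly.convCKWall_holds`) gives the unit kernel difference; the currency algebra
`(Lc^4)⁻¹·wΦ′ − (Lc^{12})⁻¹·wΦ = (Lc^4·N′^8)⁻¹·(N′^8·wΦ′ − N^8·wΦ)` (`N′ = Lc·N`); the tent by an2's `RemainderExplicitLaplacian.abs_contourSumAdj_le` translated to the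
source block as in leaf-01's `ContactAssembly.exists_common_letters` (`ContactPartnerLetters.contourSumAdj_sub_zsmul`).  HONEST FRAMING (cell contract, verbatim):
«discharging `BetaPertH` makes Bałaban's UV stability UNCONDITIONAL — a real constructive-QFT result; it is NOT the continuum limit and NOT the Clay problem.»
HONEST DEPENDENCY (verbatim): «continuum YM on T⁴ ⇐ BetaPertH ∧ nine spine estimates (0/9 proved); BetaPertH ⇐ (D1) ∧ (D4) ∧ CAP+tail; G-an2-4 gates asym, D1
and NE2/3/4.»  No cited fact, no wall binder, no `def`, no `def … : Prop`, 0 sorry; discharges NOTHING of hSdev by itself; NEVER «G-an2-4 closed»; NOT (CONV-C) as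
typed, NOT D1, NOT BetaPertH, NOT continuum, NOT Clay.

## What is proved (`d = 3`, every `Lc ≥ 2`, NO hypothesis)
* `tentDiff_kernel_eq` (the currency algebra, every `Lc`); **`tentDiff_letters_of_unitTent (hκ : 0 ≤ κ₀) k μ z (hTd)`** — PARAMETRIC in the unit-tent
  difference letter `ε` of the pair `(k+2, k+1)` at a given rate (for CT-4e's one shared letter instance); **`exists_tentDiff_letters_three (hLc : 2 ≤ Lc)`**: `∃ κ cT θ, 0 < κ ∧ 0 ≤ cT ∧ 0 ≤ θ ∧ θ < 1 ∧ ∀ k μ z`,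
  (i) `∀ κ′ y, |φ̃ κ′ y| ≤ (cT·θ^k·((Lc:ℝ)^4·((Lc:ℝ)^(k+2))^8)⁻¹)·e^{−κ‖y − z‖∞}`, (ii) `∀ κ′ w, |𝒬ᵀ_{Lc^(k+1)} φ̃ κ′ w| ≤ ((Lc^(k+1):ℕ)·(cT·θ^k·(…)⁻¹)·e^{κ})·e^{−κ‖quo (Lc^(k+1)) w − z‖∞}`,
  `φ̃ := (((Lc:ℝ)^(3+1))⁻¹·((Lc:ℝ)^(3+1))⁻¹·((Lc:ℝ)^3·Lc)) • (fun κ′ y ↦ wΦ_{Lc^(k+2)} κ′ μ (y − z)) − ((Lc:ℝ)^12)⁻¹ • (fun κ′ y ↦ wΦ_{Lc^(k+1)} κ′ μ (y − z))` — LITERALLY the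
  kernel `(cψ·cχ·((P:ℝ)^d·P))•φ′ − c₀•φ` of `ContactRefineP.abs_pairing_refine_le` at `P = Lc`, `cψ = cχ = ((Lc:ℝ)^(3+1))⁻¹`, `c₀ = ((Lc:ℝ)^12)⁻¹`.
Unit `b2b-balaban-gan24-p2` (road-P2 chair, gen 34), 2026-08-21.
-/

noncomputable section

open Finset
open scoped BigOperators
open Literature.MathematicalPhysics.QuantumFieldTheory
open Literature.MathematicalPhysics.QuantumFieldTheory.LatticeForm (quo)
open Literature.MathematicalPhysics.QuantumFieldTheory.Balaban1983to89
open Literature.MathematicalPhysics.QuantumFieldTheory.Balaban1983to89.Beta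
open B12Sec2to5 (l1 l1_nonneg)
open B4ContourShift (supNorm supNorm_nonneg)
open KernelSpecInstance (wΦ)
open AffineAveraging (Form1 Site)
open AffineReproduction (contourSumAdj)
open Summit.QuantumFields.BalabanUV.Beta.GAN24.RespStepCauchy (supNorm_le_l1)
open Summit.QuantumFields.BalabanUV.Beta.GAN24.ContactTentCauchy (exists_unitTent_letters_three)
open Summit.QuantumFields.BalabanUV.Beta.GAN24.ContactPartnerLetters (contourSumAdj_sub_zsmul quo_sub_zsmul')
open Summit.QuantumFields.BalabanUV.Beta.RemainderExplicitLaplacian (abs_contourSumAdj_le)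

namespace Summit.QuantumFields.BalabanUV.Beta.GAN24.ContactRefinePTent

variable {Lc : ℕ} [NeZero Lc]

/-- [folklore] **THE CURRENCY ALGEBRA**: at `c_ψ = c_χ = (Lc^4)⁻¹`, `c₀ = (Lc^{12})⁻¹` the third bracket's kernel is `(Lc^4·(Lc^(k+2))^8)⁻¹ ×` the unit-tent difference:
`((Lc^4)⁻¹·(Lc^4)⁻¹·(Lc^3·Lc))·a − (Lc^{12})⁻¹·b = (Lc^4·(Lc^(k+2))^8)⁻¹·((Lc^(k+2))^8·a − (Lc^(k+1))^8·b)`. -/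
theorem tentDiff_kernel_eq (k : ℕ) (a b : ℝ) :
    ((Lc : ℝ) ^ (3 + 1))⁻¹ * ((Lc : ℝ) ^ (3 + 1))⁻¹ * ((Lc : ℝ) ^ 3 * Lc) * a - ((Lc : ℝ) ^ 12)⁻¹ * b
      = ((Lc : ℝ) ^ 4 * ((Lc : ℝ) ^ (k + 2)) ^ 8)⁻¹ *
        ((((Lc : ℝ) ^ (k + 2)) ^ (2 * (3 + 1))) * a - (((Lc : ℝ) ^ (k + 1)) ^ (2 * (3 + 1))) * b) := by
  have hL : (Lc : ℝ) ≠ 0 := by exact_mod_cast NeZero.ne Lc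
  have eM : (Lc : ℝ) ^ (k + 2) = (Lc : ℝ) ^ (k + 1) * Lc := pow_succ _ _
  rw [eM]
  field_simp
  ring

/-- NOT IN PRINT; OUR BOOKKEEPING.  **THE THIRD BRACKET's LETTERS, PARAMETRIC** (`d = 3`; rate `κ₀ ≥ 0` and the unit-tent difference letter `ε` of the pair
`(k+2, k+1)` as HYPOTHESIS — CT-4d's `hKall` clause read in `‖·‖∞` at a common rate — so that CT-4e shares ONE letter instance across the cells):
(i) `|φ̃ κ′ y| ≤ (ε·((Lc:ℝ)^4·((Lc:ℝ)^(k+2))^8)⁻¹)·e^{−κ₀‖y − z‖∞}`, (ii) `|𝒬ᵀ_{Lc^(k+1)} φ̃ κ′ w| ≤ ((Lc^(k+1):ℕ)·(ε·(…)⁻¹)·e^{κ₀})·e^{−κ₀‖quo (Lc^(k+1)) w − z‖∞}`. -/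
theorem tentDiff_letters_of_unitTent {κ₀ ε : ℝ} (hκ : 0 ≤ κ₀) (k : ℕ) (μ : Fin (3 + 1)) (z : Site (3 + 1))
    (hTd : ∀ (κ' : Fin (3 + 1)) (y : Site (3 + 1)),
      |(((Lc : ℝ) ^ (k + 2)) ^ (2 * (3 + 1))) * wΦ (N := Lc ^ (k + 2)) κ' μ (y - z)
          - (((Lc : ℝ) ^ (k + 1)) ^ (2 * (3 + 1))) * wΦ (N := Lc ^ (k + 1)) κ' μ (y - z)| ≤ ε * Real.exp (-(κ₀ * supNorm (y - z)))) :
    (∀ (κ' : Fin (3 + 1)) (y : Site (3 + 1)),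
      |((((Lc : ℝ) ^ (3 + 1))⁻¹ * ((Lc : ℝ) ^ (3 + 1))⁻¹ * ((Lc : ℝ) ^ 3 * Lc)) •
            (fun (κ' : Fin (3 + 1)) (y : Site (3 + 1)) => wΦ (N := Lc ^ (k + 2)) κ' μ (y - z))
          - ((Lc : ℝ) ^ 12)⁻¹ • (fun (κ' : Fin (3 + 1)) (y : Site (3 + 1)) => wΦ (N := Lc ^ (k + 1)) κ' μ (y - z))) κ' y|
        ≤ (ε * ((Lc : ℝ) ^ 4 * ((Lc : ℝ) ^ (k + 2)) ^ 8)⁻¹) * Real.exp (-(κ₀ * supNorm (y - z)))) ∧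
    (∀ (κ' : Fin (3 + 1)) (w : Site (3 + 1)),
      |contourSumAdj (Lc ^ (k + 1))
          ((((Lc : ℝ) ^ (3 + 1))⁻¹ * ((Lc : ℝ) ^ (3 + 1))⁻¹ * ((Lc : ℝ) ^ 3 * Lc)) •
              (fun (κ' : Fin (3 + 1)) (y : Site (3 + 1)) => wΦ (N := Lc ^ (k + 2)) κ' μ (y - z))
            - ((Lc : ℝ) ^ 12)⁻¹ • (fun (κ' : Fin (3 + 1)) (y : Site (3 + 1)) => wΦ (N := Lc ^ (k + 1)) κ' μ (y - z))) κ' w|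
        ≤ ((Lc ^ (k + 1) : ℕ) * (ε * ((Lc : ℝ) ^ 4 * ((Lc : ℝ) ^ (k + 2)) ^ 8)⁻¹) * Real.exp κ₀) *
          Real.exp (-(κ₀ * supNorm (quo (Lc ^ (k + 1)) w - z)))) := by
  have hε : 0 ≤ ε := by
    have h := hTd 0 z
    exact le_of_mul_le_mul_right ((zero_mul _).le.trans_eq (by ring) |>.trans ((abs_nonneg _).trans h)) (Real.exp_pos _)
  have hker : ∀ (κ' : Fin (3 + 1)) (y : Site (3 + 1)),
      |((((Lc : ℝ) ^ (3 + 1))⁻¹ * ((Lc : ℝ) ^ (3 + 1))⁻¹ * ((Lc : ℝ) ^ 3 * Lc)) •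
            (fun (κ' : Fin (3 + 1)) (y : Site (3 + 1)) => wΦ (N := Lc ^ (k + 2)) κ' μ (y - z))
          - ((Lc : ℝ) ^ 12)⁻¹ • (fun (κ' : Fin (3 + 1)) (y : Site (3 + 1)) => wΦ (N := Lc ^ (k + 1)) κ' μ (y - z))) κ' y|
        ≤ (ε * ((Lc : ℝ) ^ 4 * ((Lc : ℝ) ^ (k + 2)) ^ 8)⁻¹) * Real.exp (-(κ₀ * supNorm (y - z))) := by
    intro κ' y
    simp only [Pi.sub_apply, Pi.smul_apply, smul_eq_mul]
    rw [tentDiff_kernel_eq (Lc := Lc) k, abs_mul, abs_inv, abs_of_nonneg (by positivity : (0 : ℝ) ≤ (Lc : ℝ) ^ 4 * ((Lc : ℝ) ^ (k + 2)) ^ 8)]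
    calc ((Lc : ℝ) ^ 4 * ((Lc : ℝ) ^ (k + 2)) ^ 8)⁻¹ *
          |(((Lc : ℝ) ^ (k + 2)) ^ (2 * (3 + 1))) * wΦ (N := Lc ^ (k + 2)) κ' μ (y - z)
            - (((Lc : ℝ) ^ (k + 1)) ^ (2 * (3 + 1))) * wΦ (N := Lc ^ (k + 1)) κ' μ (y - z)|
        ≤ ((Lc : ℝ) ^ 4 * ((Lc : ℝ) ^ (k + 2)) ^ 8)⁻¹ * (ε * Real.exp (-(κ₀ * supNorm (y - z)))) :=
          mul_le_mul_of_nonneg_left (hTd κ' y) (by positivity)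
      _ = _ := by ring
  refine ⟨hker, fun κ' w => ?_⟩
  haveI : NeZero (Lc ^ (k + 1)) := ⟨pow_ne_zero _ (NeZero.ne Lc)⟩
  have hNpos : 0 < Lc ^ (k + 1) := pow_pos (Nat.pos_of_ne_zero (NeZero.ne Lc)) _
  set ψ : Form1 (3 + 1) ℝ := (((Lc : ℝ) ^ (3 + 1))⁻¹ * ((Lc : ℝ) ^ (3 + 1))⁻¹ * ((Lc : ℝ) ^ 3 * Lc)) •
      (fun (κ' : Fin (3 + 1)) (y : Site (3 + 1)) => wΦ (N := Lc ^ (k + 2)) κ' μ (y - z))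
    - ((Lc : ℝ) ^ 12)⁻¹ • (fun (κ' : Fin (3 + 1)) (y : Site (3 + 1)) => wΦ (N := Lc ^ (k + 1)) κ' μ (y - z)) with hψ
  have h := abs_contourSumAdj_le (d := 3) hNpos (φ := fun κ' y => ψ κ' (y + z))
    (B := ε * ((Lc : ℝ) ^ 4 * ((Lc : ℝ) ^ (k + 2)) ^ 8)⁻¹) (κ₀ := κ₀) (by positivity) hκ
    (fun κ' y => by have h' := hker κ' (y + z); simp only [hψ, add_sub_cancel_right] at h' ⊢; exact h')
    κ' (w - ((Lc ^ (k + 1) : ℕ) : ℤ) • z)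
  rw [contourSumAdj_sub_zsmul, quo_sub_zsmul'] at h
  have e : (fun κ' y => (fun κ' y => ψ κ' (y + z)) κ' (y - z)) = ψ := by
    funext κ' y; simp only [sub_add_cancel]
  rw [e] at h
  exact h

/-- NOT IN PRINT; OUR BOOKKEEPING.  **THE THIRD BRACKET's KERNEL AND TENT LETTERS** (`d = 3`, every `Lc ≥ 2`, NO hypothesis): for
`φ̃ := (((Lc:ℝ)^(3+1))⁻¹·((Lc:ℝ)^(3+1))⁻¹·((Lc:ℝ)^3·Lc)) • (κ′ y ↦ wΦ_{Lc^(k+2)} κ′ μ (y − z)) − ((Lc:ℝ)^12)⁻¹ • (κ′ y ↦ wΦ_{Lc^(k+1)} κ′ μ (y − z))`,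
(i) `|φ̃ κ′ y| ≤ (cT·θ^k·((Lc:ℝ)^4·((Lc:ℝ)^(k+2))^8)⁻¹)·e^{−κ‖y − z‖∞}` and (ii) `|𝒬ᵀ_{Lc^(k+1)} φ̃ κ′ w| ≤ ((Lc^(k+1):ℕ)·(cT·θ^k·(…)⁻¹)·e^{κ})·e^{−κ‖quo (Lc^(k+1)) w − z‖∞}` —
the `hφt ∕ htt` slots of `ContactRefineP.abs_pairing_refine_le` (`P = Lc`, `N = Lc^(k+1)`, `cψ = cχ = ((Lc:ℝ)^(3+1))⁻¹`, `c₀ = ((Lc:ℝ)^12)⁻¹`), `θ` the K-slot rate. -/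
theorem exists_tentDiff_letters_three (hLc : 2 ≤ Lc) :
    ∃ κ cT θ : ℝ, 0 < κ ∧ 0 ≤ cT ∧ 0 ≤ θ ∧ θ < 1 ∧
      ∀ (k : ℕ) (μ : Fin (3 + 1)) (z : Site (3 + 1)),
        (∀ (κ' : Fin (3 + 1)) (y : Site (3 + 1)),
          |((((Lc : ℝ) ^ (3 + 1))⁻¹ * ((Lc : ℝ) ^ (3 + 1))⁻¹ * ((Lc : ℝ) ^ 3 * Lc)) •
                (fun (κ' : Fin (3 + 1)) (y : Site (3 + 1)) => wΦ (N := Lc ^ (k + 2)) κ' μ (y - z))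
              - ((Lc : ℝ) ^ 12)⁻¹ • (fun (κ' : Fin (3 + 1)) (y : Site (3 + 1)) => wΦ (N := Lc ^ (k + 1)) κ' μ (y - z))) κ' y|
            ≤ (cT * θ ^ k * ((Lc : ℝ) ^ 4 * ((Lc : ℝ) ^ (k + 2)) ^ 8)⁻¹) * Real.exp (-(κ * supNorm (y - z)))) ∧
        (∀ (κ' : Fin (3 + 1)) (w : Site (3 + 1)),
          |contourSumAdj (Lc ^ (k + 1))
              ((((Lc : ℝ) ^ (3 + 1))⁻¹ * ((Lc : ℝ) ^ (3 + 1))⁻¹ * ((Lc : ℝ) ^ 3 * Lc)) •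
                  (fun (κ' : Fin (3 + 1)) (y : Site (3 + 1)) => wΦ (N := Lc ^ (k + 2)) κ' μ (y - z))
                - ((Lc : ℝ) ^ 12)⁻¹ • (fun (κ' : Fin (3 + 1)) (y : Site (3 + 1)) => wΦ (N := Lc ^ (k + 1)) κ' μ (y - z))) κ' w|
            ≤ ((Lc ^ (k + 1) : ℕ) * (cT * θ ^ k * ((Lc : ℝ) ^ 4 * ((Lc : ℝ) ^ (k + 2)) ^ 8)⁻¹) * Real.exp κ) *
              Real.exp (-(κ * supNorm (quo (Lc ^ (k + 1)) w - z)))) := by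
  obtain ⟨-, δ, cK, θ, hδ, hθ0, hθ1, -, hKall⟩ := exists_unitTent_letters_three (Lc := Lc) hLc
  have hcK : 0 ≤ cK := by
    have h := hKall 0 0 0 0 0 0
    simp only [sub_self, abs_zero, pow_zero, mul_one] at h
    exact le_of_mul_le_mul_right ((zero_mul _).le.trans_eq (by ring) |>.trans h) (Real.exp_pos _)
  refine ⟨δ, cK, θ, hδ, hcK, hθ0, hθ1, fun k μ z => ?_⟩
  -- CT-4d's letter at the pair `(k+2, k+1)`, `ℓ¹ → ‖·‖∞`
  have hTd : ∀ (κ' : Fin (3 + 1)) (y : Site (3 + 1)),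
      |(((Lc : ℝ) ^ (k + 2)) ^ (2 * (3 + 1))) * wΦ (N := Lc ^ (k + 2)) κ' μ (y - z)
          - (((Lc : ℝ) ^ (k + 1)) ^ (2 * (3 + 1))) * wΦ (N := Lc ^ (k + 1)) κ' μ (y - z)| ≤ (cK * θ ^ k) * Real.exp (-(δ * supNorm (y - z))) := by
    intro κ' y
    have h := hKall k 1 κ' μ y z
    rw [show k + 1 + 1 = k + 2 from rfl] at h
    have henv : Real.exp (-δ * l1 (y - z)) ≤ Real.exp (-(δ * supNorm (y - z))) := by
      rw [Real.exp_le_exp, neg_mul, neg_le_neg_iff]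
      exact mul_le_mul_of_nonneg_left (supNorm_le_l1 _) hδ.le
    exact h.trans (mul_le_mul_of_nonneg_left henv (by positivity))
  exact tentDiff_letters_of_unitTent hδ.le k μ z hTd

end Summit.QuantumFields.BalabanUV.Beta.GAN24.ContactRefinePTent

end
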